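import Mathlib
import HarnessLib
import Literature.LinearAlgebra.Matrix.UnitaryGroupConjugacyClasses

/-!
# The engine's `SU(N)` spectral kernel is well defined and conjugation-equivariant: permutation-equivariant eigenvalue maps, degenerate spectra included

HONEST FRAMING: exact (Metropolis-corrected) sampling algorithms for lattice gauge theory;
figures of merit are autocorrelation/cost numbers at stated couplings and volumes; no
continuum-physics claim.

Venture `LatticeQCDFlow` (cell pub-lqcd), topic `Exactness`; FANOUT row 10 (`eng-equiv`, engine
`latflow.equiv`, module `equiv/spectral.py`: `unitary_eig` → `canonicalise` → box flow →
`uncanonicalise` → `recompose`, i.e. the kernel `W = V diag(λ) V† ↦ V diag(f λ) V†` of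
`spectral_kernel` / `SUNSpectralCoupling`, releases `equiv-0.2.0 … 0.4.1`; the same kernel in
`latflow.flows_jax.spectral_jax`).  NEW WORK of the cell over Mathlib and the tree's
`Literature/LinearAlgebra/Matrix/UnitaryGroup{MaximalTorus,WeylGroup,ConjugacyClasses}.lean`
(Bröcker–tom Dieck IV (2.5), (3.1), (3.2) for `U(n)` / `SU(n)`: the diagonal torus, unitary
diagonalisation, conjugate diagonal matrices differ by a permutation, monomial matrices);
nothing is cited as a fact; no number; no definition is introduced.  Printed counterpart, NAMED
ONLY: Boyda, Kanwar, Racanière, Rezende, Albergo, Cranmer, Hackett, Shanahan, *Sampling using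
`SU(N)` gauge equivariant flows*, Phys. Rev. D 103 (2021) 074504, §III ("a kernel can generally
be defined as an invertible map that acts on the list of eigenvalues of the input matrix, is
equivariant under permutations of the eigenvalues, and leaves the eigenvectors unchanged") and
App. A (Lemma 1, Proposition 2).  Sequel: `SpectralKernelMap.lean` (the kernel as a map on
`U(n)` / `SU(n)`; necessity, App. A Prop. 1).

## The question the engine's kernel raises

`numpy.linalg.eig` returns the eigenvalues of the loop `W` in an ARBITRARY order and, on a
degenerate spectrum, an ARBITRARY unitary frame of each eigenspace.  The kernel recomposes
`V diag(f λ) V†` from whatever `(V, λ)` it was handed.  For the output to be a function of `W`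
alone — and to commute with `W ↦ X W X†`, which is what makes the plaquette coupling layer gauge
equivariant — the eigenvalue map `f` must be PERMUTATION EQUIVARIANT, `f (λ ∘ σ) = (f λ) ∘ σ`;
this file proves that this is also sufficient, with no genericity assumption on the spectrum.

## Content (`n` any finite index type; matrices over `ℂ`; `U(n) = Matrix.unitaryGroup n ℂ`)

* combinatorics of eigenvalue tuples: `apply_eq_apply_of_perm_equivariant` — a
  permutation-equivariant `f` gives tied eigenvalues tied images (App. A, first half of Lemma 1);
  `perm_equivariant_of_pointwise` — maps `λ_i ↦ φ(s λ, λ_i)` through a symmetric statistic `s`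
  are permutation equivariant; **`perm_equivariant_of_canonicalisation`** — the engine's recipe
  (canonicalise the tuple by a permutation-INVARIANT rule `c`, act by any `g` on the canonical
  tuple, hand each eigenvalue the image of the canonical slot that holds it) is permutation
  equivariant — the hypothesis `hf` forces `g` to give tied canonical slots equal images, which
  is the degenerate-spectrum (cell-wall) consistency condition;
* `diagonal_commute_of_commute` — a matrix commuting with `diag(d)` commutes with `diag(e)`
  whenever `e` is constant on the level sets of `d` (App. A Lemma 1, second half; any
  commutative ring without zero divisors);
* `exists_eq_conj_diagonal_of_mem_unitaryGroup` / `…_specialUnitaryGroup` — every `P ∈ U(n)`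
  (`SU(n)`) IS `V diag(d) V⋆` with `V ∈ U(n)` (`SU(n)`) (the tree's IV (3.1), rearranged);
  `exists_perm_of_unitary_conj_diagonal`, `permMatrix_conj_diagonal`;
* **`conj_diagonal_map_eq_of_perm_equivariant`** — THE CORE: `M ∈ U(n)`,
  `M diag(d) M⋆ = diag(d')`, `f` permutation equivariant ⟹ `M diag(f d) M⋆ = diag(f d')`
  (`d'` is a permutation of `d` by the characteristic polynomial; split `M` = permutation
  matrix × a unitary commuting with `diag(d)`);
* **`spectralKernel_wellDefined`** (App. A Prop. 2): two unitary diagonalisations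
  `V diag(d) V⋆ = W diag(d') W⋆` of the same matrix give the same output
  `V diag(f d) V⋆ = W diag(f d') W⋆`; **`spectralKernel_conj`**: the output for `X P X⋆`
  (`X ∈ U(n)`) is `X · (output for P) · X⋆`, whatever diagonalisations are used on either side;
* values: `conj_diagonal_mem_unitaryGroup`, `det_conj_diagonal` (`= ∏ e_i`),
  `conj_diagonal_mem_specialUnitaryGroup`, `norm_eq_one_of_eq_conj_diagonal`,
  `prod_eq_one_of_eq_conj_diagonal` (the spectrum of `P ∈ U(n)` is unimodular, of `P ∈ SU(n)`
  has product `1`) — so a unimodularity- and product-preserving `f` keeps the output in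
  `U(n)` / `SU(n)` (the `det = 1` surface of Boyda Fig. 4).

NOT here: smoothness / the Jacobian of the kernel (the Haar–Vandermonde factor of Boyda eq. (19)
and Algorithm 2); the kernel as a map and its conjugation equivariance `h(XUX⁻¹) = X h(U) X⁻¹`
(`SpectralKernelMap.lean`); the lattice coupling layer (`KernelCouplingGaugeEquivariance.lean`);
any number.
-/

namespace Summit.Ventures.LatticeQCDFlow.Exactness

open Matrix
open Literature.LinearAlgebra.Matrix
open Literature.MathematicalPhysics.QuantumLattice (diagonal_mem_unitaryGroup_iff)

/-! ## Eigenvalue tuples: permutation equivariance, ties, canonicalisation -/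

section Tuples

variable {ι α β γ : Type*}

/-- **Tied eigenvalues get tied images.**  If `f` is permutation equivariant and `d i = d j`,
then `f d i = f d j` (swap `i` and `j`: the swap fixes `d`, so it fixes `f d`). -/
theorem apply_eq_apply_of_perm_equivariant [DecidableEq ι] {f : (ι → α) → (ι → β)}
    (hf : ∀ (σ : Equiv.Perm ι) (d : ι → α), f (fun k => d (σ k)) = fun k => f d (σ k))
    {d : ι → α} {i j : ι} (h : d i = d j) : f d i = f d j := by
  have hd : (fun k => d (Equiv.swap i j k)) = d := by
    funext k
    by_cases hki : k = i
    · rw [hki, Equiv.swap_apply_left, h]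
    · by_cases hkj : k = j
      · rw [hkj, Equiv.swap_apply_right, h]
      · rw [Equiv.swap_apply_of_ne_of_ne hki hkj]
  have key := hf (Equiv.swap i j) d
  rw [hd] at key
  have hi := congr_fun key i
  simpa only [Equiv.swap_apply_left] using hi

/-- **Pointwise maps through a symmetric statistic are permutation equivariant**: if
`f d i = φ (s d) (d i)` with `s` permutation INVARIANT (e.g. `s d = ∏ d`, the determinant, or the
whole multiset of eigenvalues), then `f` is permutation equivariant.  (`U(N)` kernels acting on
each eigenvalue separately are the case of constant `s`.) -/
theorem perm_equivariant_of_pointwise {f : (ι → α) → (ι → β)} {s : (ι → α) → γ} {φ : γ → α → β}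
    (hs : ∀ (σ : Equiv.Perm ι) (d : ι → α), s (fun k => d (σ k)) = s d)
    (hf : ∀ (d : ι → α) (i : ι), f d i = φ (s d) (d i)) :
    ∀ (σ : Equiv.Perm ι) (d : ι → α), f (fun k => d (σ k)) = fun k => f d (σ k) := by
  intro σ d
  funext k
  rw [hf, hf, hs]

/-- **Eigenvalue canonicalisation gives a permutation-equivariant map** (the engine's
`canonicalise` / box flow / `uncanonicalise`).  Data: a canonicalisation `c` that is permutation
INVARIANT (`c (d ∘ σ) = c d`: it depends on the multiset of eigenvalues only, e.g. a sort into the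
canonical cell) and loses no eigenvalue (`hcov`: every `d i` occupies some canonical slot `j`,
`c d j = d i`), an arbitrary map `g` acting on canonical tuples, and the output rule `hf`:
eigenvalue `i` receives the image under `g` of a canonical slot holding it.  Then `f` is
permutation equivariant.  (On a degenerate spectrum several slots hold the same eigenvalue and
`hf` can only be met if `g (c d)` takes the same value on them — the consistency condition at
the walls of the cell; on regular spectra the slot is unique.) -/
theorem perm_equivariant_of_canonicalisation {c : (ι → α) → (ι → α)} {g : (ι → α) → (ι → β)}
    {f : (ι → α) → (ι → β)}
    (hc : ∀ (σ : Equiv.Perm ι) (d : ι → α), c (fun k => d (σ k)) = c d)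
    (hcov : ∀ (d : ι → α) (i : ι), ∃ j, c d j = d i)
    (hf : ∀ (d : ι → α) (i j : ι), c d j = d i → f d i = g (c d) j) :
    ∀ (σ : Equiv.Perm ι) (d : ι → α), f (fun k => d (σ k)) = fun k => f d (σ k) := by
  intro σ d
  funext i
  obtain ⟨j, hj⟩ := hcov (fun k => d (σ k)) i
  rw [hf _ i j hj]
  rw [hc] at hj
  rw [hc, hf d (σ i) j hj]

end Tuples

/-! ## App. A, Lemma 1: commuting with `diag(d)` forces commuting with `diag(f d)` -/

section Centralizer

variable {R : Type*} [CommRing R] [NoZeroDivisors R] {n : Type*} [Fintype n] [DecidableEq n]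

/-- **A matrix commuting with `diag(d)` commutes with `diag(e)` whenever `e` is constant on the
level sets of `d`.**  Entrywise: `C i j · (d j − d i) = 0`, so `C i j = 0` unless `d i = d j`,
and then `e i = e j`. -/
theorem diagonal_commute_of_commute {C : Matrix n n R} {d e : n → R}
    (hC : C * diagonal d = diagonal d * C) (hde : ∀ i j, d i = d j → e i = e j) :
    C * diagonal e = diagonal e * C := by
  ext i j
  have hij : C i j * d j = d i * C i j := by
    have h := congr_fun (congr_fun hC i) j
    rwa [mul_diagonal, diagonal_mul] at h
  rw [mul_diagonal, diagonal_mul]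
  by_cases h0 : C i j = 0
  · rw [h0, zero_mul, mul_zero]
  · have hd : d i = d j := by
      have h1 : C i j * (d j - d i) = 0 := by rw [mul_sub, hij]; ring
      rcases mul_eq_zero.mp h1 with h2 | h2
      · exact absurd h2 h0
      · exact (sub_eq_zero.mp h2).symm
    rw [hde i j hd, mul_comm]

end Centralizer

/-! ## The core: `M diag(d) M⋆ = diag(d')` with `M` unitary transports `diag(f d)` to `diag(f d')` -/

section Unitary

variable {n : Type*} [Fintype n] [DecidableEq n]

/-- `V ∈ U(n)` ⟹ `P = V (V⋆ P V) V⋆`: turning the tree's `V⋆ U V = diag(d)` into `U = V diag(d) V⋆`. -/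
theorem eq_conj_of_star_conj_eq {P V D : Matrix n n ℂ} (hV : V ∈ Matrix.unitaryGroup n ℂ)
    (h : star V * P * V = D) : P = V * D * star V := by
  calc P = (V * star V) * P * (V * star V) := by
        rw [Unitary.mul_star_self_of_mem hV, Matrix.one_mul, Matrix.mul_one]
    _ = V * (star V * P * V) * star V := by simp only [Matrix.mul_assoc]
    _ = V * D * star V := by rw [h]

/-- **Every `P ∈ U(n)` has a unitary diagonalisation `P = V diag(d) V⋆`** (the tree's
`exists_unitaryGroup_conj_eq_diagonal`, Bröcker–tom Dieck IV (3.1), rearranged). -/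
theorem exists_eq_conj_diagonal_of_mem_unitaryGroup {P : Matrix n n ℂ}
    (hP : P ∈ Matrix.unitaryGroup n ℂ) :
    ∃ V ∈ Matrix.unitaryGroup n ℂ, ∃ d : n → ℂ, P = V * diagonal d * star V := by
  obtain ⟨V, hV, d, hd⟩ := exists_unitaryGroup_conj_eq_diagonal P hP
  exact ⟨V, hV, d, eq_conj_of_star_conj_eq hV hd⟩

/-- **Every `P ∈ SU(n)` has a special-unitary diagonalisation `P = V diag(d) V⋆`, `V ∈ SU(n)`**
(the tree's `exists_specialUnitaryGroup_conj_eq_diagonal`, rearranged). -/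
theorem exists_eq_conj_diagonal_of_mem_specialUnitaryGroup {P : Matrix n n ℂ}
    (hP : P ∈ Matrix.specialUnitaryGroup n ℂ) :
    ∃ V ∈ Matrix.specialUnitaryGroup n ℂ, ∃ d : n → ℂ, P = V * diagonal d * star V := by
  obtain ⟨V, hV, d, hd⟩ := exists_specialUnitaryGroup_conj_eq_diagonal P hP
  exact ⟨V, hV, d, eq_conj_of_star_conj_eq (Matrix.mem_specialUnitaryGroup_iff.mp hV).1 hd⟩

/-- **Conjugate diagonal matrices by a unitary differ by a permutation of the diagonal**:
`M ∈ U(n)`, `M diag(d) M⋆ = diag(d')` ⟹ `d' = d ∘ σ` (characteristic polynomials; the tree's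
`exists_perm_of_charpoly_diagonal_eq`). -/
theorem exists_perm_of_unitary_conj_diagonal {M : Matrix n n ℂ} (hM : M ∈ Matrix.unitaryGroup n ℂ)
    {d d' : n → ℂ} (h : M * diagonal d * star M = diagonal d') :
    ∃ σ : Equiv.Perm n, ∀ i, d' i = d (σ i) := by
  apply exists_perm_of_charpoly_diagonal_eq
  rw [← h, charpoly_conj_of_mem_unitaryGroup hM]

/-- The permutation matrix `monomial σ⁻¹ 1` is unitary and conjugates `diag(e)` to `diag(e ∘ σ)`. -/
theorem permMatrix_conj_diagonal (σ : Equiv.Perm n) (e : n → ℂ) :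
    monomial σ⁻¹ (fun _ => (1 : ℂ)) * diagonal e * star (monomial σ⁻¹ (fun _ => (1 : ℂ))) =
      diagonal fun i => e (σ i) := by
  rw [star_eq_conjTranspose,
    monomial_mul_diagonal_mul_conjTranspose (σ := σ⁻¹) (fun _ => norm_one) e]
  simp only [inv_inv]

/-- **THE CORE (App. A, Lemma 1 + the heart of Prop. 2).**  Let `f` be permutation equivariant,
`M ∈ U(n)` and `M diag(d) M⋆ = diag(d')`.  Then `M diag(f d) M⋆ = diag(f d')`.
Proof: `d' = d ∘ σ`; with the permutation matrix `P` of `σ`, `C = P⋆ M` is a unitary commuting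
with `diag(d)`, hence (ties of `d` are ties of `f d`, `apply_eq_apply_of_perm_equivariant`;
`diagonal_commute_of_commute`) with `diag(f d)`; so
`M diag(f d) M⋆ = P diag(f d) P⋆ = diag((f d) ∘ σ) = diag(f (d ∘ σ)) = diag(f d')`. -/
theorem conj_diagonal_map_eq_of_perm_equivariant {f : (n → ℂ) → (n → ℂ)}
    (hf : ∀ (σ : Equiv.Perm n) (d : n → ℂ), f (fun k => d (σ k)) = fun k => f d (σ k))
    {M : Matrix n n ℂ} (hM : M ∈ Matrix.unitaryGroup n ℂ) {d d' : n → ℂ}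
    (h : M * diagonal d * star M = diagonal d') :
    M * diagonal (f d) * star M = diagonal (f d') := by
  obtain ⟨σ, hσ⟩ := exists_perm_of_unitary_conj_diagonal hM h
  have hd' : d' = fun i => d (σ i) := funext hσ
  -- the permutation matrix of `σ`
  set P : Matrix n n ℂ := monomial σ⁻¹ (fun _ => (1 : ℂ)) with hPdef
  have hPu : P ∈ Matrix.unitaryGroup n ℂ :=
    monomial_mem_unitaryGroup_iff.mpr fun _ => norm_one
  have hPs : star P * P = 1 := Unitary.star_mul_self_of_mem hPu
  have hPs' : P * star P = 1 := Unitary.mul_star_self_of_mem hPu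
  have hPconj : ∀ e : n → ℂ, P * diagonal e * star P = diagonal fun i => e (σ i) :=
    fun e => permMatrix_conj_diagonal σ e
  -- `C = P⋆ M` commutes with `diag(d)`
  set C : Matrix n n ℂ := star P * M with hCdef
  have hCu : C ∈ Matrix.unitaryGroup n ℂ := Submonoid.mul_mem _ (Unitary.star_mem hPu) hM
  have hCs : star C * C = 1 := Unitary.star_mul_self_of_mem hCu
  have hCs' : C * star C = 1 := Unitary.mul_star_self_of_mem hCu
  have hCd : C * diagonal d * star C = diagonal d := by
    calc C * diagonal d * star C = star P * (M * diagonal d * star M) * P := by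
          rw [hCdef, star_mul, star_star]; simp only [Matrix.mul_assoc]
      _ = star P * (P * diagonal d * star P) * P := by rw [h, hd', hPconj d]
      _ = (star P * P) * diagonal d * (star P * P) := by simp only [Matrix.mul_assoc]
      _ = diagonal d := by rw [hPs, Matrix.one_mul, Matrix.mul_one]
  have hCcomm : C * diagonal d = diagonal d * C := by
    calc C * diagonal d = C * diagonal d * (star C * C) := by rw [hCs, Matrix.mul_one]
      _ = (C * diagonal d * star C) * C := by simp only [Matrix.mul_assoc]
      _ = diagonal d * C := by rw [hCd]
  -- hence with `diag(f d)`
  have hfd : ∀ i j, d i = d j → f d i = f d j :=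
    fun i j hij => apply_eq_apply_of_perm_equivariant hf hij
  have hCf : C * diagonal (f d) = diagonal (f d) * C := diagonal_commute_of_commute hCcomm hfd
  have hCfd : C * diagonal (f d) * star C = diagonal (f d) := by
    rw [hCf, Matrix.mul_assoc, hCs', Matrix.mul_one]
  -- `M = P C`
  have hMPC : M = P * C := by rw [hCdef, ← Matrix.mul_assoc, hPs', Matrix.one_mul]
  calc M * diagonal (f d) * star M = P * (C * diagonal (f d) * star C) * star P := by
        rw [hMPC, star_mul]; simp only [Matrix.mul_assoc]
    _ = diagonal fun i => f d (σ i) := by rw [hCfd, hPconj]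
    _ = diagonal (f d') := by rw [hd', hf σ d]

/-- **The spectral kernel is WELL DEFINED (Boyda et al. App. A, Prop. 2).**  Two unitary
diagonalisations of the same matrix, `V diag(d) V⋆ = W diag(d') W⋆` with `V, W ∈ U(n)` (any
ordering of the eigenvalues, any frames of the eigenspaces), give the same output:
`V diag(f d) V⋆ = W diag(f d') W⋆`, for every permutation-equivariant `f`. -/
theorem spectralKernel_wellDefined {f : (n → ℂ) → (n → ℂ)}
    (hf : ∀ (σ : Equiv.Perm n) (d : n → ℂ), f (fun k => d (σ k)) = fun k => f d (σ k))
    {V W : Matrix n n ℂ} (hV : V ∈ Matrix.unitaryGroup n ℂ) (hW : W ∈ Matrix.unitaryGroup n ℂ)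
    {d d' : n → ℂ} (h : V * diagonal d * star V = W * diagonal d' * star W) :
    V * diagonal (f d) * star V = W * diagonal (f d') * star W := by
  have hWs : star W * W = 1 := Unitary.star_mul_self_of_mem hW
  have hWs' : W * star W = 1 := Unitary.mul_star_self_of_mem hW
  have hM : star W * V ∈ Matrix.unitaryGroup n ℂ := Submonoid.mul_mem _ (Unitary.star_mem hW) hV
  have hMd : star W * V * diagonal d * star (star W * V) = diagonal d' := by
    rw [star_mul, star_star]
    calc star W * V * diagonal d * (star V * W) = star W * (V * diagonal d * star V) * W := by
          simp only [Matrix.mul_assoc]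
      _ = star W * (W * diagonal d' * star W) * W := by rw [h]
      _ = (star W * W) * diagonal d' * (star W * W) := by simp only [Matrix.mul_assoc]
      _ = diagonal d' := by rw [hWs, Matrix.one_mul, Matrix.mul_one]
  have key := conj_diagonal_map_eq_of_perm_equivariant hf hM hMd
  calc V * diagonal (f d) * star V
        = (W * star W) * (V * diagonal (f d) * star V) * (W * star W) := by
          rw [hWs', Matrix.one_mul, Matrix.mul_one]
    _ = W * (star W * V * diagonal (f d) * star (star W * V)) * star W := by
          rw [star_mul, star_star]; simp only [Matrix.mul_assoc]
    _ = W * diagonal (f d') * star W := by rw [key]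

/-- **The spectral kernel is CONJUGATION EQUIVARIANT.**  If `P = V diag(d) V⋆` and
`X P X⋆ = W diag(d') W⋆` are unitary diagonalisations (`X, V, W ∈ U(n)`), then
`W diag(f d') W⋆ = X (V diag(f d) V⋆) X⋆`: the output for `X P X⋆`, computed from ANY
diagonalisation of it, is the conjugate by `X` of the output for `P`. -/
theorem spectralKernel_conj {f : (n → ℂ) → (n → ℂ)}
    (hf : ∀ (σ : Equiv.Perm n) (d : n → ℂ), f (fun k => d (σ k)) = fun k => f d (σ k))
    {X V W : Matrix n n ℂ} (hX : X ∈ Matrix.unitaryGroup n ℂ) (hV : V ∈ Matrix.unitaryGroup n ℂ)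
    (hW : W ∈ Matrix.unitaryGroup n ℂ) {d d' : n → ℂ}
    (h : X * (V * diagonal d * star V) * star X = W * diagonal d' * star W) :
    X * (V * diagonal (f d) * star V) * star X = W * diagonal (f d') * star W := by
  have hXV : X * V ∈ Matrix.unitaryGroup n ℂ := Submonoid.mul_mem _ hX hV
  have h' : X * V * diagonal d * star (X * V) = W * diagonal d' * star W := by
    rw [← h, star_mul]; simp only [Matrix.mul_assoc]
  rw [← spectralKernel_wellDefined hf hXV hW h', star_mul]
  simp only [Matrix.mul_assoc]

/-! ## Values: unitary, determinant `∏ f(λ)_i`, special unitary -/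

/-- `V diag(e) V⋆ ∈ U(n)` for `V ∈ U(n)` and unimodular `e`. -/
theorem conj_diagonal_mem_unitaryGroup {V : Matrix n n ℂ} (hV : V ∈ Matrix.unitaryGroup n ℂ)
    {e : n → ℂ} (he : ∀ i, ‖e i‖ = 1) : V * diagonal e * star V ∈ Matrix.unitaryGroup n ℂ :=
  Submonoid.mul_mem _ (Submonoid.mul_mem _ hV ((diagonal_mem_unitaryGroup_iff e).mpr he))
    (Unitary.star_mem hV)

/-- `det (V diag(e) V⋆) = ∏ i, e i` for `V ∈ U(n)`. -/
theorem det_conj_diagonal {V : Matrix n n ℂ} (hV : V ∈ Matrix.unitaryGroup n ℂ) (e : n → ℂ) :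
    (V * diagonal e * star V).det = ∏ i, e i := by
  rw [det_mul, det_mul, det_diagonal, mul_comm V.det, mul_assoc, ← det_mul,
    Unitary.mul_star_self_of_mem hV, det_one, mul_one]

/-- `V diag(e) V⋆ ∈ SU(n)` for `V ∈ U(n)`, unimodular `e` with `∏ e = 1`. -/
theorem conj_diagonal_mem_specialUnitaryGroup {V : Matrix n n ℂ} (hV : V ∈ Matrix.unitaryGroup n ℂ)
    {e : n → ℂ} (he : ∀ i, ‖e i‖ = 1) (hprod : ∏ i, e i = 1) :
    V * diagonal e * star V ∈ Matrix.specialUnitaryGroup n ℂ :=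
  Matrix.mem_specialUnitaryGroup_iff.mpr
    ⟨conj_diagonal_mem_unitaryGroup hV he, by rw [det_conj_diagonal hV, hprod]⟩

/-- **The spectrum of a unitary matrix is unimodular**: `P ∈ U(n)`, `P = V diag(d) V⋆`,
`V ∈ U(n)` ⟹ `‖d i‖ = 1`. -/
theorem norm_eq_one_of_eq_conj_diagonal {P V : Matrix n n ℂ} (hP : P ∈ Matrix.unitaryGroup n ℂ)
    (hV : V ∈ Matrix.unitaryGroup n ℂ) {d : n → ℂ} (h : P = V * diagonal d * star V) (i : n) :
    ‖d i‖ = 1 := by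
  have hVs : star V * V = 1 := Unitary.star_mul_self_of_mem hV
  have hd : diagonal d = star V * P * V := by
    rw [h]
    calc diagonal d = (star V * V) * diagonal d * (star V * V) := by
          rw [hVs, Matrix.one_mul, Matrix.mul_one]
      _ = star V * (V * diagonal d * star V) * V := by simp only [Matrix.mul_assoc]
  have hdu : diagonal d ∈ Matrix.unitaryGroup n ℂ := by
    rw [hd]
    exact Submonoid.mul_mem _ (Submonoid.mul_mem _ (Unitary.star_mem hV) hP) hV
  exact norm_eq_one_of_diagonal_mem_unitaryGroup hdu i

/-- **The spectrum of a special unitary matrix has product one**: `P ∈ SU(n)`,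
`P = V diag(d) V⋆`, `V ∈ U(n)` ⟹ `∏ i, d i = 1`. -/
theorem prod_eq_one_of_eq_conj_diagonal {P V : Matrix n n ℂ} (hP : P ∈ Matrix.specialUnitaryGroup n ℂ)
    (hV : V ∈ Matrix.unitaryGroup n ℂ) {d : n → ℂ} (h : P = V * diagonal d * star V) :
    ∏ i, d i = 1 := by
  rw [← det_conj_diagonal hV d, ← h]
  exact (Matrix.mem_specialUnitaryGroup_iff.mp hP).2

end Unitary

end Summit.Ventures.LatticeQCDFlow.Exactness
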